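import Literature.MathematicalPhysics.QuantumFieldTheory.Balaban1983to89.Node00.Record13CarriersXPinnedH
import Literature.MathematicalPhysics.QuantumFieldTheory.Balaban1983to89.Node00.Record13CarriersXPinnedHCoPH
import Literature.MathematicalPhysics.QuantumFieldTheory.Balaban1983to89.Node00.Record13SClassSepCoPH

/-!
v1.7 `CoPH` IMAGE (token map T₇ of dag-lead WORDS-143 ∕ node00-def-T `KEYMAP-Record13-v1.7.md`: binder `θ : Stage13HParams` (= `Stage13RParams` + the HISTORY-INDEXED residual 𝐓-weight slot `Zh`, director-ym №183 FINDING №9), `CoPR ↦ CoPH`, dotted `Stage13RParams.X ↦ Stage13HParams.X`, SITE-RULE `X F N θ ↦ X F N θ.toStage13Params` for the edition-free θ-level objects) of this seat's v1.6 file of the same stem (which STANDS as a settled helper, as does the v1.5 one); H-level pins over dag-n10-d's `Stage13HParams.rebindX` (`Node00/Record13CarriersCoPH` §0, p539476).  Prose pids ∕ FILE numbers below are those of the v1.5 ∕ v1.6 lineage where not updated; this image's v1.7 suppliers are node00-def-T FILE 27 p537939 `Record13CoPH` ∕ FILE 28T p539169 `Record13SepCoPH`, dag-n10-d g11 p539476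 `Record13CarriersCoPH` ∕ p540513 `Record13CarriersSepCoPH` ∕ p542283 `Record13SClassSepCoPH` (the generic S-class `IsRecordOfRecord₁₃CSepCoPHS`, of which this seat's S-bound records are one-pin ∕ X-H-pin ∕ four-pin-view SLICES — membership lemmas `isRecordOfRecord₁₃CSepCoPHS_of_…` below).

# NODE 00 (YM-PLAN Track A) — THE S-BOUND X-PINNED STAGE-13 RECORD AT THE v1.7 KEY: `IsRecordOfRecord₁₃CSepCoPHSX3H` — def-T's `IsRecordOfRecord₁₃CSepCoPH` VERBATIM except that
# the world is bound by the S-BINDING `upOfRecord₅CS` over the H-X-PINNED view `(θ.pinX3H lam8 lam12 lam13).toStage5₁₃CoPH` (`Node00/Record13CarriersXPinnedH(CoPH)`): ONE world that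
# carries N05's SURVIVING leaf `B8LeafOfRecordSubBH θ₃ lam8` (the slot this base's knits serve) TOGETHER WITH the engine's N09 ∕ N10 X-sockets at `lam12 ∕ lam13` and the Y ∕ Z ∕ W
# leaves — companion in `IsRecordOfRecord₁₃CSepCoPH` (same datum, leaves equal off `b8`, typed ⇒ surviving), the reading, the slot form, the rebind

NODE 00 RECORD MODULE (seat `pub-ymgap-dag-n05-d` g7, 2026-08-27; APPEND-ONLY, everything BY NAME).  = this seat's `Record13CarriersB8SubBHCoPH` §2 (p523976) with the one-pin
view `pinB8SubBH lam` replaced by the three-layer H-X-pin `pinX3H lam8 lam12 lam13`.  WHY: the K1 engine binds ONE world per presenting parameter; at an X-pinned world under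
the C-binding N05's leaf is the TYPED Theorem-8 form (not what the knits prove) and at the un-repaired X-pin it is FALSE (`BalabanUVNodesN05XPinVacuity`); under the S-binding at the
H-X-pin it is the REPAIRED SURVIVING slot (`socket05S_toStage5₁₃CoPH_pinX3H_iff`, `Iff.rfl`), served by `BalabanUVNodesN05SubBHKnitUnivT8Srv` at `lam8 := λ.cutSubB J (zdLan ∘ ι) c₁`
modulo its displayed hypotheses, while every other leaf is the C-binding's at the same X-pin (`upOfRecord₅CS_toStage5₁₃CoPH_pinX3H_offB8`) — so N09 ∕ N10 ∕ N06 ∕ N07 ∕ N12 read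
exactly what they read at dag-n10-d's ∕ dag-n24-c's X-pinned presentations.  Whether the engine adopts this record is dag-n24-c's ∕ the plan's word.
WHAT IS DEFINED ∕ PROVED: `IsRecordOfRecord₁₃CSepCoPHSX3H` (def), `exists_world_…` (world displayed), `companion_of_…`, `leaf_b8_iff_of_…`, `leaf_b8_iff_subB_and_t8H_of_…`,
`exists_isRecordOfRecord₁₃CSepCoPH_of_…`, `exists_isRecordOfRecord₁₃CCoPH_of_…`, `b4_b5_b6_b7_of_…`, `b8_b11_b10_main_iff_of_…`, `b8_main_of_…_of_slot`, `b8_main_of_…_of_subB_fields`,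
`…_rebind_of_isRecordOfRecord₁₃CSepCoPH`, `exists_provisos_of_…`.
HONEST FRAMING: one definition + kernel bookkeeping; NO estimate; nothing of Bałaban's asserted; N05 NOT discharged; K1 NOT claimed; counts unmoved; one finite T⁴ programme at
fixed ε — NOT continuum ∕ ℝ⁴ ∕ OS ∕ mass gap ∕ Clay.  No `sorry`, no `axiom`, no `instance`, no `notation`.
[Balaban1985RegularSpaces] = Commun. Math. Phys. **99** (1985) 75–102; [Balaban1989LargeFieldII] = Commun. Math. Phys. **122** (1989) 355–392; [Balaban1988Convergent] = Commun.
Math. Phys. **119** (1988) 243–285.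
-/

noncomputable section

namespace Literature.MathematicalPhysics.QuantumFieldTheory.Balaban1983to89.Node00

open T4Continuum AveragingRT T4FiniteEpsInhabited FlowStep FlowStepRuns DagBinding T4DatumAssembly
open B8LeafKnitRS (B8LeafRS)
open B8IdxB8LawsB (IdxB8SubB famB8OfRecordSubB)
open scoped Matrix.Norms.L2Operator

/-! ## The S-bound X-pinned Stage-13 record at the v1.7 key; companion in `₁₃CSepCoPH`; faces; the reading; rebind -/

section Record13SepCoPHSX3H

variable (F : T4Family) (N : ℕ) [NeZero N]

/-- **«(D, w) is the record, Stage 13 (separated range), [B8] group pinned over the four-law sub-index ON THE REPAIRED CARRIER, `b8` surviving»**: def-T's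
`IsRecordOfRecord₁₃CSepCoPH` VERBATIM except that the world is bound by the S-binding over the H-X-PINNED Stage-13 view (`pinX3H`: [B8] at the repaired members, [B12] frame of record, [B13] group of record), for SOME layers `lam8 lam12 lam13`.
[cite: Balaban1985RegularSpaces, Lemma 1 – Thm 8 pp.79–101, Thm 8 (1.146) p.101, (1.12) p.78; Balaban1989LargeFieldII, Thm 1 + (0.1) pp.355–356 (objects of record)] -/
def IsRecordOfRecord₁₃CSepCoPHSX3H (D : FiniteEpsData F (SU N)) (w : WorldP) : Prop :=
  ∃ (θ : Stage13HParams F N) (h : θ.Provisos₁₃SepCoPH F N) (lam8 : ResidB8 θ.toStage3Params) (lam12 : ResidB12 F N θ.τ9.M)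
    (lam13 : B12.RunParams → ResidB13 θ.toStage3Params),
    θ.Admissible F N ∧ D = datumOfRecord₁₃SepCoPH F N θ h ∧ w.C = D.C ∧ (0 < w.γ ∧ w.γ ≤ θ.γ) ∧ w.L = (θ.L : ℝ) ∧
      ∀ P : B12.RunParams, w.up P = upOfRecord₅CS F N ((θ.pinX3H F N lam8 lam12 lam13).toStage5₁₃CoPH F N) P

/-- Inhabitation is Stage 13's exactly (the residual [B8] type is inhabited, `nonempty_residB8`): every admissible separated-range parameter presents a record of this module
at its own datum, ANY residual layer `lam`, any window. [cite: Balaban1989LargeFieldII, Thm 1 + (0.1) pp.355–356 (bookkeeping)] -/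
theorem exists_world_isRecordOfRecord₁₃CSepCoPHSX3H (θ : Stage13HParams F N) (h : θ.Provisos₁₃SepCoPH F N) (hθ : θ.Admissible F N) (lam8 : ResidB8 θ.toStage3Params)
    (lam12 : ResidB12 F N θ.τ9.M) (lam13 : B12.RunParams → ResidB13 θ.toStage3Params) {γw : ℝ} (hγw : 0 < γw ∧ γw ≤ θ.γ) :
    ∃ w : WorldP, IsRecordOfRecord₁₃CSepCoPHSX3H F N (datumOfRecord₁₃SepCoPH F N θ h) w ∧ w.γ = γw ∧
      ∀ P : B12.RunParams, w.up P = upOfRecord₅CS F N ((θ.pinX3H F N lam8 lam12 lam13).toStage5₁₃CoPH F N) P := by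
  obtain ⟨w₀, -, -⟩ := exists_world_isRecordOfRecord₁₃CSepCoPH F N θ h hθ hγw
  exact ⟨{ w₀ with
      C := (datumOfRecord₁₃SepCoPH F N θ h).C, γ := γw, L := (θ.L : ℝ), one_lt_L := by exact_mod_cast θ.hL.2,
      up := fun P => upOfRecord₅CS F N ((θ.pinX3H F N lam8 lam12 lam13).toStage5₁₃CoPH F N) P },
    ⟨θ, h, lam8, lam12, lam13, hθ, rfl, rfl, hγw, rfl, fun _ => rfl⟩, rfl, fun _ => rfl⟩

variable {F N}
variable {D : FiniteEpsData F (SU N)} {w : WorldP}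

/-- **A record of this module IS a member of dag-n10-d's generic S-class `IsRecordOfRecord₁₃CSepCoPHS`** (`Record13SClassSepCoPH`, p542283): the REPAIRED-X-PIN SLICE (dag-n10-d's
`isRecordOfRecord₁₃CSepCoPHS_pinX3H_of_eq`); through it the class's consequence family applies at every record of this module BY NAME.
[cite: Balaban1989LargeFieldII, Thm 1 + (0.1) pp.355–356 (bookkeeping)] -/
theorem isRecordOfRecord₁₃CSepCoPHS_of_isRecordOfRecord₁₃CSepCoPHSX3H (h : IsRecordOfRecord₁₃CSepCoPHSX3H F N D w) :
    IsRecordOfRecord₁₃CSepCoPHS F N D w := by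
  obtain ⟨θ, hP, lam8, lam12, lam13, hθ, hD, hC, hγ, hL, hup⟩ := h
  subst hD
  exact isRecordOfRecord₁₃CSepCoPHS_pinX3H_of_eq F N θ hP hθ lam8 lam12 lam13 w hC hγ hL hup

/-- **THE SAME-DATUM COMPANION IN `IsRecordOfRecord₁₃CSepCoPH`** (witness `θ.pinX3H lam8 lam12 lam13` under the C-binding): same `D`, `C`, window, `L`; leaves agree off `b8`; companion's
`b8` (typed, over the repaired sub-family) ⇒ record's `b8` (surviving) under the carrier law (1.36) ⊂ (1.62) — never conversely.
[cite: Balaban1985RegularSpaces, Thm 8 p.101 (surviving vs typed); Balaban1989LargeFieldII, Thm 1 + (0.1) pp.355–356 (bookkeeping)] -/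
theorem companion_of_isRecordOfRecord₁₃CSepCoPHSX3H (h : IsRecordOfRecord₁₃CSepCoPHSX3H F N D w) :
    ∃ w' : WorldP, IsRecordOfRecord₁₃CSepCoPH F N D w' ∧ w'.C = w.C ∧ w'.γ = w.γ ∧ w'.L = w.L ∧
      (∀ P : B12.RunParams, leavesP w P = { leavesP w' P with b8 := (leavesP w P).b8 }) ∧
      ∀ P : B12.RunParams, (leavesP w' P).b8 → (leavesP w P).b8 := by
  obtain ⟨θ, hP, lam8, lam12, lam13, hθ, hD, hC, hγ, hL, hup⟩ := h
  subst hD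
  have hup' : ∀ P, w.up P = (upOfRecord₅C F N ((θ.pinX3H F N lam8 lam12 lam13).toStage5₁₃CoPH F N) P).withB8 (leavesP w P).b8 := fun P => by
    show w.up P = (upOfRecord₅C F N _ P).withB8 (w.up P).b8
    rw [hup P]
    exact upOfRecord₅CS_eq_withB8 F N _ P
  -- the companion IS the C-bound record at the H-X-pin (`isRecordOfRecord₁₃CSepCoPH_pinX3H_of_eq`, through dag-n10-d's generic re-binding record — the by-hand
  -- 8-tuple at the three-layer pin is the comparison that exhausts the default heartbeats)
  refine ⟨{ w with up := fun P => upOfRecord₅C F N ((θ.pinX3H F N lam8 lam12 lam13).toStage5₁₃CoPH F N) P },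
    isRecordOfRecord₁₃CSepCoPH_pinX3H_of_eq θ hP hθ lam8 lam12 lam13 _ hC hγ hL (fun _ => rfl), rfl, rfl, rfl,
      leavesP_eq_of_up_withB8 hup', fun P h8 => ?_⟩
  show (w.up P).b8
  rw [hup P]
  exact b8S_of_b8_toStage5₁₃CoPH_pinX3H F N θ lam8 lam12 lam13 P h8

/-- The `b8` leaf at a record of this module, for ONE parameter package: it IS the repaired slot. [cite: Balaban1985RegularSpaces, Lemma 1 – Thm 8 pp.79–101 (bookkeeping)] -/
theorem leaf_b8_iff_of_isRecordOfRecord₁₃CSepCoPHSX3H (h : IsRecordOfRecord₁₃CSepCoPHSX3H F N D w) :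
    ∃ (θ : Stage13HParams F N) (lam : ResidB8 θ.toStage3Params), θ.Admissible F N ∧ w.L = (θ.L : ℝ) ∧
      ∀ P : B12.RunParams, (leavesP w P).b8 ↔ B8LeafOfRecordSubBH θ.toStage3Params lam := by
  obtain ⟨θ, -, lam8, lam12, lam13, hθ, -, -, -, hL, hup⟩ := h
  refine ⟨θ, lam8, hθ, hL, fun P => ?_⟩
  show (w.up P).b8 ↔ _
  rw [hup P]
  exact socket05S_toStage5₁₃CoPH_pinX3H_iff F N θ lam8 lam12 lam13 P

/-- **THE READING AT THE RECORD**: at a record of this module the `b8` leaf is, for its presenting package, «the old pin's EIGHT non-Theorem-8 conjuncts (over `famB8OfRecordSubB`,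
letter for letter the knits' conclusions) ∧ Theorem 8 surviving at γ = 1 AT THE REPAIRED MEMBERS» (`CarriersB8SubBH.b8LeafOfRecordSubBH_iff_subB_and_t8H`).
[cite: Balaban1985RegularSpaces, Lemma 1 p.79, Thm 2 p.83, Prop. 3 p.87, Thm 4 p.88, Prop. 5 p.94, Prop. 6 p.99, Prop. 7 p.100, Thm 8 (1.146) p.101] -/
theorem leaf_b8_iff_subB_and_t8H_of_isRecordOfRecord₁₃CSepCoPHSX3H (h : IsRecordOfRecord₁₃CSepCoPHSX3H F N D w) :
    ∃ (θ : Stage13HParams F N) (lam : ResidB8 θ.toStage3Params), θ.Admissible F N ∧ w.L = (θ.L : ℝ) ∧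
      ∀ P : B12.RunParams, (leavesP w P).b8 ↔
        (B8.Lemma1Printed θ.D (B8Lemma1NonAbelian.blockPairNA θ.D θ.L θ.𝔸) ∧
          B8.Thm2Printed (fun j : IdxB8SubB θ.toStage3Params => (famB8OfRecordSubB θ.toStage3Params lam.β lam.len j).toGFData) ∧
          B8.Prop3Printed θ.D (θ.L : ℝ) lam.C₂ lam.inp lam.B₀β
            (fun j : IdxB8SubB θ.toStage3Params => (famB8OfRecordSubB θ.toStage3Params lam.β lam.len j).toGFData2) ∧
          B8.Thm4Printed lam.B₁' (fun j : IdxB8SubB θ.toStage3Params => (famB8OfRecordSubB θ.toStage3Params lam.β lam.len j).toGFData) ∧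
          B8.Prop5Exists lam.inp.B₀' lam.B₁ lam.lan ∧ B8.Prop5Unique lam.lan ∧ B8.Prop6Printed θ.D (θ.L : ℝ) lam.B₁ lam.c₁ lam.cub ∧
          B8SectGH.Prop7PrintedR (fun j : IdxB8SubB θ.toStage3Params => famB8OfRecordSubB θ.toStage3Params lam.β lam.len j) (fun j => lam.toAxial j.1)) ∧
        B8Thm8Surviving.Thm8SurvivingAt 1 lam.B₁ lam.B₂ (fun j : IdxB8SubB θ.toStage3Params => famB8OfRecordSubBH θ.toStage3Params lam.β lam.len j) := by
  obtain ⟨θ, lam, hθ, hL, hiff⟩ := leaf_b8_iff_of_isRecordOfRecord₁₃CSepCoPHSX3H h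
  exact ⟨θ, lam, hθ, hL, fun P => (hiff P).trans (b8LeafOfRecordSubBH_iff_subB_and_t8H lam)⟩

/-- A record of this module IS (through its companion) a separated-range Stage-13 record of the same datum at a world with the same `C ∕ γ ∕ L`.
[cite: Balaban1989LargeFieldII, Thm 1 + (0.1) pp.355–356 (bookkeeping)] -/
theorem exists_isRecordOfRecord₁₃CSepCoPH_of_isRecordOfRecord₁₃CSepCoPHSX3H (h : IsRecordOfRecord₁₃CSepCoPHSX3H F N D w) :
    ∃ w' : WorldP, IsRecordOfRecord₁₃CSepCoPH F N D w' ∧ w'.C = w.C ∧ w'.γ = w.γ ∧ w'.L = w.L := by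
  obtain ⟨w', hw', hC, hγ, hL, -, -⟩ := companion_of_isRecordOfRecord₁₃CSepCoPHSX3H h
  exact ⟨w', hw', hC, hγ, hL⟩

/-- … hence (along `IsRecordOfRecord₁₃CSepCoPH.toCoPH`) a Co CORE Stage-13 record of the same datum at a world with the same `C ∕ γ ∕ L` — the projection by which storeys
keyed ONCE on FILE 21's core family serve this record. [cite: Balaban1989LargeFieldII, Thm 1 + (0.1) pp.355–356 (bookkeeping)] -/
theorem exists_isRecordOfRecord₁₃CCoPH_of_isRecordOfRecord₁₃CSepCoPHSX3H (h : IsRecordOfRecord₁₃CSepCoPHSX3H F N D w) :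
    ∃ w' : WorldP, IsRecordOfRecord₁₃CCoPH F N D w' ∧ w'.C = w.C ∧ w'.γ = w.γ ∧ w'.L = w.L := by
  obtain ⟨w', hw', hC, hγ, hL⟩ := exists_isRecordOfRecord₁₃CSepCoPH_of_isRecordOfRecord₁₃CSepCoPHSX3H h
  exact ⟨w', hw'.toCoPH, hC, hγ, hL⟩

/-- The in-edges `b4 b5 b6 b7` are THEOREMS at a record of this module (via the companion and def-T's v1.7 transfer `atWorld_of_isRecordOfRecord₁₃CSepCoPH`).
[cite: Balaban1983RegularityDecay, Thm p.573; Balaban1984PropagatorsI, Props. 1.1–1.2 pp.33–36; Balaban1984PropagatorsII, pp.223–250; Balaban1985Averaging, Props. 1–10 pp.26–50 (bookkeeping)] -/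
theorem b4_b5_b6_b7_of_isRecordOfRecord₁₃CSepCoPHSX3H (h : IsRecordOfRecord₁₃CSepCoPHSX3H F N D w) (P : B12.RunParams) :
    (leavesP w P).b4 ∧ (leavesP w P).b5 ∧ (leavesP w P).b6 ∧ (leavesP w P).b7 := by
  obtain ⟨w', hw', -, -, -, hleaves, -⟩ := companion_of_isRecordOfRecord₁₃CSepCoPHSX3H h
  have h' : (leavesP w' P).b4 ∧ (leavesP w' P).b5 ∧ (leavesP w' P).b6 ∧ (leavesP w' P).b7 :=
    atWorld_of_isRecordOfRecord₁₃CSepCoPH (X := fun ℓ => ℓ.b4 ∧ ℓ.b5 ∧ ℓ.b6 ∧ ℓ.b7)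
      (fun _ _ h5 P =>
        have h4 := b4_main_of_isRecordOfRecord₅C h5 P
        have hb5 := b5_main_of_isRecordOfRecord₅C h5 P h4
        ⟨h4, hb5, N03_at_record₅C h5 P h4 hb5, b7_main_of_isRecordOfRecord₅C h5 P hb5⟩) hw' P
  rw [hleaves P]
  exact h'

/-- **N05 ∕ N07 ∕ N08 AT A RECORD OF THIS MODULE** (in-edges b4–b7 are theorems). [cite: Balaban1985RegularSpaces, Thm 2 p.83, Thm 8 p.101; Balaban1985Variational, Thm 1 p.279; Balaban1985UV3, Thm 1 p.257 (bookkeeping)] -/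
theorem b8_b11_b10_main_iff_of_isRecordOfRecord₁₃CSepCoPHSX3H (h : IsRecordOfRecord₁₃CSepCoPHSX3H F N D w) (P : B12.RunParams) :
    (Dag.B8_main (leavesP w P) ↔ ((leavesP w P).b9 → (leavesP w P).b8)) ∧
    (Dag.B11_main (leavesP w P) ↔ ((leavesP w P).b8 → (leavesP w P).b9 → (leavesP w P).b11)) ∧
    (Dag.B10_main (leavesP w P) ↔ ((leavesP w P).b8 → (leavesP w P).b9 → (leavesP w P).b11 → (leavesP w P).b10)) := by
  obtain ⟨-, h5, h6, h7⟩ := b4_b5_b6_b7_of_isRecordOfRecord₁₃CSepCoPHSX3H h P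
  exact ⟨⟨fun hN h9 => hN h5 h6 h7 h9, fun hN _ _ _ => hN⟩, ⟨fun hN h8 h9 => hN h5 h6 h7 h8 h9, fun hN _ _ _ => hN⟩,
    ⟨fun hN h8 h9 h11 => hN h5 h6 h7 h8 h9 h11, fun hN _ _ _ => hN⟩⟩

/-- **N05 «SLOT» FORM at a record of this module**: a closer of the REPAIRED slot `B8LeafOfRecordSubBH` at every presenting package gives `Dag.B8_main` at every run.
[cite: Balaban1985RegularSpaces, Lemma 1 – Thm 8 pp.79–101, Thm 8 (1.146) p.101 (the node's shape, bookkeeping)] -/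
theorem b8_main_of_isRecordOfRecord₁₃CSepCoPHSX3H_of_slot (h : IsRecordOfRecord₁₃CSepCoPHSX3H F N D w)
    (hB : ∀ (θ : Stage13HParams F N) (hP : θ.Provisos₁₃SepCoPH F N) (lam8 : ResidB8 θ.toStage3Params) (lam12 : ResidB12 F N θ.τ9.M)
      (lam13 : B12.RunParams → ResidB13 θ.toStage3Params), θ.Admissible F N → D = datumOfRecord₁₃SepCoPH F N θ hP →
      (∀ P, w.up P = upOfRecord₅CS F N ((θ.pinX3H F N lam8 lam12 lam13).toStage5₁₃CoPH F N) P) → B8LeafOfRecordSubBH θ.toStage3Params lam8)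
    (P : B12.RunParams) : Dag.B8_main (leavesP w P) := by
  obtain ⟨h8iff, -, -⟩ := b8_b11_b10_main_iff_of_isRecordOfRecord₁₃CSepCoPHSX3H h P
  obtain ⟨θ, hP, lam8, lam12, lam13, hθ, hD, -, -, -, hup⟩ := h
  refine h8iff.2 fun _ => ?_
  show (w.up P).b8
  rw [hup P]
  exact (socket05S_toStage5₁₃CoPH_pinX3H_iff F N θ lam8 lam12 lam13 P).2 (hB θ hP lam8 lam12 lam13 hθ hD hup)

/-- **N05 «SLOT» FORM, READ**: a supplier of the old pin's EIGHT conjuncts and of Theorem 8 surviving AT THE REPAIRED MEMBERS, at every presenting package, gives `Dag.B8_main` at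
every run of a record of this module (the slot form through `b8LeafOfRecordSubBH_of_subB_fields`). [cite: Balaban1985RegularSpaces, Lemma 1 – Thm 8 pp.79–101, Thm 8 (1.146) p.101] -/
theorem b8_main_of_isRecordOfRecord₁₃CSepCoPHSX3H_of_subB_fields (h : IsRecordOfRecord₁₃CSepCoPHSX3H F N D w)
    (hB : ∀ (θ : Stage13HParams F N) (hP : θ.Provisos₁₃SepCoPH F N) (lam : ResidB8 θ.toStage3Params) (lam12 : ResidB12 F N θ.τ9.M)
      (lam13 : B12.RunParams → ResidB13 θ.toStage3Params), θ.Admissible F N → D = datumOfRecord₁₃SepCoPH F N θ hP →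
      (∀ P, w.up P = upOfRecord₅CS F N ((θ.pinX3H F N lam lam12 lam13).toStage5₁₃CoPH F N) P) →
        (B8.Lemma1Printed θ.D (B8Lemma1NonAbelian.blockPairNA θ.D θ.L θ.𝔸) ∧
          B8.Thm2Printed (fun j : IdxB8SubB θ.toStage3Params => (famB8OfRecordSubB θ.toStage3Params lam.β lam.len j).toGFData) ∧
          B8.Prop3Printed θ.D (θ.L : ℝ) lam.C₂ lam.inp lam.B₀β
            (fun j : IdxB8SubB θ.toStage3Params => (famB8OfRecordSubB θ.toStage3Params lam.β lam.len j).toGFData2) ∧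
          B8.Thm4Printed lam.B₁' (fun j : IdxB8SubB θ.toStage3Params => (famB8OfRecordSubB θ.toStage3Params lam.β lam.len j).toGFData) ∧
          B8.Prop5Exists lam.inp.B₀' lam.B₁ lam.lan ∧ B8.Prop5Unique lam.lan ∧ B8.Prop6Printed θ.D (θ.L : ℝ) lam.B₁ lam.c₁ lam.cub ∧
          B8SectGH.Prop7PrintedR (fun j : IdxB8SubB θ.toStage3Params => famB8OfRecordSubB θ.toStage3Params lam.β lam.len j) (fun j => lam.toAxial j.1)) ∧
        B8Thm8Surviving.Thm8SurvivingAt 1 lam.B₁ lam.B₂ (fun j : IdxB8SubB θ.toStage3Params => famB8OfRecordSubBH θ.toStage3Params lam.β lam.len j))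
    (P : B12.RunParams) : Dag.B8_main (leavesP w P) :=
  b8_main_of_isRecordOfRecord₁₃CSepCoPHSX3H_of_slot h
    (fun θ hP lam lam12 lam13 hθ hD hup => (b8LeafOfRecordSubBH_iff_subB_and_t8H lam).2 (hB θ hP lam lam12 lam13 hθ hD hup)) P

/-- RE-BINDING a `₁₃CSep` record's world by the S-binding over the [B8″H]-pinned view gives a record of this module with the SAME datum — the ∃-currency entry point (the [B8]
layer `lam`, e.g. the cut layer `λ.cutSubB J lan c₁`, is CHOSEN here). [cite: Balaban1989LargeFieldII, Thm 1 p.355 (bookkeeping)] -/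
theorem isRecordOfRecord₁₃CSepCoPHSX3H_rebind_of_isRecordOfRecord₁₃CSepCoPH (h : IsRecordOfRecord₁₃CSepCoPH F N D w) :
    ∃ (θ : Stage13HParams F N) (_ : θ.Provisos₁₃SepCoPH F N), θ.Admissible F N ∧ (∀ P, w.up P = upOfRecord₅C F N (θ.toStage5₁₃CoPH F N) P) ∧
      ∀ (lam8 : ResidB8 θ.toStage3Params) (lam12 : ResidB12 F N θ.τ9.M) (lam13 : B12.RunParams → ResidB13 θ.toStage3Params),
        IsRecordOfRecord₁₃CSepCoPHSX3H F N D { w with up := fun P => upOfRecord₅CS F N ((θ.pinX3H F N lam8 lam12 lam13).toStage5₁₃CoPH F N) P } := by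
  obtain ⟨θ, hP, hθ, hD, hC, hγ, hL, hup⟩ := h
  exact ⟨θ, hP, hθ, hup, fun lam8 lam12 lam13 => ⟨θ, hP, lam8, lam12, lam13, hθ, hD, hC, hγ, hL, fun _ => rfl⟩⟩

/-- Every record of this module sits at a v1.7 datum of record presented by admissible separated-range parameters (projection). [cite: Balaban1989LargeFieldII, Thm 1 + (0.1) pp.355–356 (bookkeeping)] -/
theorem exists_provisos_of_isRecordOfRecord₁₃CSepCoPHSX3H (h : IsRecordOfRecord₁₃CSepCoPHSX3H F N D w) :
    ∃ (θ : Stage13HParams F N) (hP : θ.Provisos₁₃SepCoPH F N), θ.Admissible F N ∧ D = datumOfRecord₁₃SepCoPH F N θ hP := by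
  obtain ⟨θ, hP, -, -, -, hθ, hD, -⟩ := h
  exact ⟨θ, hP, hθ, hD⟩

end Record13SepCoPHSX3H

#print axioms companion_of_isRecordOfRecord₁₃CSepCoPHSX3H
#print axioms b8_main_of_isRecordOfRecord₁₃CSepCoPHSX3H_of_subB_fields

end Literature.MathematicalPhysics.QuantumFieldTheory.Balaban1983to89.Node00

end
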